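import Summits.AtomisticToContinuum.HydrodynamicLimit.Theorems.AntiMazurCoboundariesCorrectorPressureDecayKiferTangent
import Literature.Analysis.FunctionSpaces.PointConfigVagueTopology
import Literature.Analysis.FluidPDE.HardSphereTorusMeasure
import Mathlib.MeasureTheory.Measure.Haar.Unique
import Mathlib.Topology.UrysohnsLemma

/-!
# Bias continuity along tangent states, III: uniform integrability of velocities under a tangent family

Helper file 3/5 of crux stmt-AtomisticToContinuum-14135 `AntiMazurCoboundaries.CorrectorPressureDecay`, line `FirstLemma` (idea `kifer-compactification`), registered stub `stub_tangentBias : TangentBias`;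
namespace `…Theorems.KiferCompactification` (wave-2 stub-worker B of lead a1, split by the lead).
`velocityTail_of_isTangentFamily` (registered as `stub_velocityTail`): for a tangent family (probability laws `Q k`
with `KL(Q k ‖ G_{N k}) ≤ κ (N k + 1)` relative to the local Gibbs law with Gaussian velocities `N(u₀, θ)`), for
every `δ > 0` there is a radius `R` with `(N k + 1)⁻¹ E_{Q k}[#{i : R < ‖vᵢ‖}] ≤ δ` for ALL `k` — the entropy
inequality `E_Q[γ #] ≤ KL + log E_G[e^{γ #}]` (`integral_le_toReal_klDiv_add_log`), independence of the
velocities given the positions (`lintegral_localGibbsMeasure`), `E_G[e^{γ#}] = (1 + (e^γ − 1) p_R)^{N+1}` with the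
Gaussian tail `p_R → 0`; `γ = 2κ/δ`. References: Olla–Varadhan–Yau 1993 §4 Lemma 4.1; Kipnis–Landim 1999 App. 1
Thm 8.3.
-/


noncomputable section

open MeasureTheory ProbabilityTheory Set Filter Topology
open scoped ENNReal

namespace Summit.AtomisticToContinuum.HydrodynamicLimit.Theorems.KiferCompactification

open Literature.MathematicalPhysics.KineticTheory (T3 V3 hsDiameter localGibbsLaw blowUpPoint hsDiameter_pos
  succ_mul_hsDiameter_pow_three localGibbsLaw_eq localGibbsMeasure localGibbsMeasure_univ posPartition
  posPartition_nonneg lintegral_localGibbsMeasure lintegral_posWeight_eq_one velMeasure zipConfig zipConfig_apply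
  gaussMeasure lintegral_fintype_prod_eq_prod' canonicalPartition_eq_posPartition)
open Literature.MathematicalPhysics.KineticTheory.PointProcess (laplaceFunctional)
open Literature.Analysis.FluidPDE (HardSphereFlow Config windowSumReal particlesIn particlesIn_eq mem_particlesIn_iff)
open Literature.Analysis.FluidPDE.Torus (reprSym symCube measurable_reprSym map_reprSym_volume proj_reprSym
  closedBall_subset_symCube)
open Literature.Analysis.FunctionSpaces (PointConfig)
open Literature.Analysis.FunctionSpaces.Torus (proj unitCube continuous_proj measurableSet_unitCube mem_unitCube)

/-- Coordinates of labelled configurations are measurable: the velocity of particle `i`. -/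
private theorem measurable_vel' {n : ℕ} (i : Fin n) : Measurable fun z : Config n (Fin 3) T3 => (z i).2 :=
  (measurable_pi_apply i).snd

/-- **FACT (uniform integrability of velocities under a tangent family).** For a tangent family (probability laws
`Q k` with `KL(Q k ‖ G_{N k}) ≤ κ (N k + 1)` relative to the local Gibbs law with Gaussian velocities
`N(u₀, θ)`): for every `δ > 0` there is a radius `R` with `(N k + 1)⁻¹ E_{Q k}[#{i : R < ‖vᵢ‖}] ≤ δ` for ALL `k`.
Proof route (not in the tree): entropy inequality `E_Q[γ #] ≤ KL + log E_G[e^{γ #}]`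
(`Literature.Probability.Divergences.integral_le_toReal_klDiv_add_log`), independence of the velocities given the
positions (`lintegral_localGibbsMeasure`), `E_G[e^{γ#}] = (1 + (e^γ − 1) p_R)^{N+1}` with the Gaussian tail
`p_R → 0`; choose `γ = 2κ/δ`, then `R`. [cite OllaVaradhanYau1993, §4 Lemma 4.1; KipnisLandim1999, App. 1 Thm 8.3] -/
theorem velocityTail_of_isTangentFamily {σ a θ : ℝ} {u₀ : V3} {κ : ℝ} (ha : 0 < a) (hθ : 0 < θ) (hκ : 0 < κ)
    {N : ℕ → ℕ}
    {Φ : ∀ k, HardSphereFlow (Literature.Analysis.FluidPDE.Torus.geometry (Fin 3)) (hsDiameter σ (N k)) (N k + 1)}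
    {Q : ∀ k, Measure (Config (N k + 1) (Fin 3) T3)} (hfam : IsTangentFamily σ a θ u₀ κ N Φ Q)
    {δ : ℝ} (hδ : 0 < δ) :
    ∃ R : ℝ, 0 < R ∧ ∀ k, ((N k + 1 : ℕ) : ℝ)⁻¹ *
      ∫ z, (∑ i, ({v : V3 | R < ‖v‖}).indicator (fun _ => (1 : ℝ)) (z i).2) ∂Q k ≤ δ := by
  classical
  obtain ⟨-, hQprob, hKL, -⟩ := hfam
  -- the tilt parameter `γ` and the Gaussian tail threshold `p₀`
  set γ : ℝ := 2 * κ / δ with hγdef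
  have hγ : 0 < γ := by positivity
  have heγ : 0 < Real.exp γ - 1 := by linarith [Real.add_one_lt_exp hγ.ne']
  set p₀ : ℝ := γ * δ / (2 * (Real.exp γ - 1)) with hp₀def
  have hp₀ : 0 < p₀ := by positivity
  -- Gaussian tails vanish
  set gauss : Measure V3 := gaussMeasure u₀ θ with hgauss
  have hmS : ∀ r : ℝ, MeasurableSet {v : V3 | r < ‖v‖} := fun r =>
    measurableSet_lt measurable_const continuous_norm.measurable
  have htend : Tendsto (fun m : ℕ => gauss {v : V3 | (m : ℝ) < ‖v‖}) atTop (𝓝 0) := by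
    have h := tendsto_measure_iInter_atTop (μ := gauss) (s := fun m : ℕ => {v : V3 | (m : ℝ) < ‖v‖})
      (fun m => (hmS m).nullMeasurableSet)
      (fun m m' hmm' v hv => show (m : ℝ) < ‖v‖ from lt_of_le_of_lt (by exact_mod_cast hmm') hv)
      ⟨0, measure_ne_top _ _⟩
    have hempty : (⋂ m : ℕ, {v : V3 | (m : ℝ) < ‖v‖}) = ∅ := by
      ext v
      simp only [mem_iInter, mem_setOf_eq, mem_empty_iff_false, iff_false, not_forall, not_lt]
      exact ⟨⌈‖v‖⌉₊, Nat.le_ceil _⟩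
    rw [hempty, measure_empty] at h
    exact h
  obtain ⟨m, hm⟩ : ∃ m : ℕ, gauss {v : V3 | (m : ℝ) < ‖v‖} < ENNReal.ofReal p₀ :=
    (htend.eventually (gt_mem_nhds (ENNReal.ofReal_pos.2 hp₀))).exists
  set R : ℝ := (m : ℝ) + 1 with hRdef
  have hR : 0 < R := by positivity
  -- the Gaussian tail mass beyond `R`
  set pR : ℝ := (gauss {v : V3 | R < ‖v‖}).toReal with hpRdef
  have hpR0 : 0 ≤ pR := ENNReal.toReal_nonneg
  have hpR1 : pR ≤ 1 := by
    rw [hpRdef, ← ENNReal.toReal_one]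
    exact ENNReal.toReal_mono ENNReal.one_ne_top prob_le_one
  have hpRp₀ : pR ≤ p₀ := by
    have hsub : {v : V3 | R < ‖v‖} ⊆ {v : V3 | (m : ℝ) < ‖v‖} := fun v hv =>
      show (m : ℝ) < ‖v‖ from lt_trans (by linarith : (m : ℝ) < R) hv
    exact ENNReal.toReal_le_of_le_ofReal hp₀.le ((measure_mono hsub).trans hm.le)
  refine ⟨R, hR, fun k => ?_⟩
  haveI := hQprob k
  -- the reference law is a probability measure (finite entropy forces `Q k ≪ G ≠ 0`)
  set Gm : Measure (Config (N k + 1) (Fin 3) T3) :=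
    localGibbsMeasure σ (fun _ => a) (fun _ => u₀) (fun _ => θ) (N k) with hGm
  have hGeq : localGibbsLaw σ (fun _ => a) (fun _ => u₀) (fun _ => θ) (N k) (Φ k) = Gm :=
    localGibbsLaw_eq σ _ _ _ (N k) (Φ k)
  have hKLk : InformationTheory.klDiv (Q k) Gm ≤ ENNReal.ofReal (κ * (N k + 1)) := by
    have h := hKL k
    rwa [hGeq] at h
  have hfin : InformationTheory.klDiv (Q k) Gm ≠ ⊤ := ne_top_of_le_ne_top ENNReal.ofReal_ne_top hKLk
  have hac : Q k ≪ Gm := (InformationTheory.klDiv_ne_top_iff.1 hfin).1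
  have huniv := localGibbsMeasure_univ (a₀ := fun _ => a) (θ₀ := fun _ => θ) (u₀ := fun _ => u₀)
    continuous_const continuous_const continuous_const (fun _ => ha.le) (fun _ => hθ) σ (N k)
  set Z : ℝ := posPartition (fun _ : T3 => a) (hsDiameter σ (N k)) (N k + 1) with hZ
  have hZ0 : 0 ≤ Z := posPartition_nonneg (fun _ => ha.le) _ _
  have hZne : Z ≠ 0 := by
    intro hZ0'
    have hG0 : Gm univ = 0 := by
      show localGibbsMeasure σ (fun _ => a) (fun _ => u₀) (fun _ => θ) (N k) univ = 0
      rw [huniv, hZ0']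
      simp
    have hQ0 : Q k univ = 0 := hac hG0
    exact absurd hQ0 (by rw [measure_univ]; exact one_ne_zero)
  haveI hGprob : IsProbabilityMeasure Gm := by
    constructor
    show localGibbsMeasure σ (fun _ => a) (fun _ => u₀) (fun _ => θ) (N k) univ = 1
    rw [huniv, ← ENNReal.ofReal_mul (inv_nonneg.2 hZ0), inv_mul_cancel₀ hZne, ENNReal.ofReal_one]
  -- the test function of the entropy inequality
  set F : Config (N k + 1) (Fin 3) T3 → ℝ :=
    fun z => ∑ i, ({v : V3 | R < ‖v‖}).indicator (fun _ => (1 : ℝ)) (z i).2 with hF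
  have hFm : Measurable F := Finset.measurable_sum _ fun i _ => (measurable_const.indicator (hmS R)).comp
    (measurable_vel' i)
  have hind01 : ∀ v : V3, 0 ≤ ({v : V3 | R < ‖v‖}).indicator (fun _ => (1 : ℝ)) v ∧
      ({v : V3 | R < ‖v‖}).indicator (fun _ => (1 : ℝ)) v ≤ 1 := fun v =>
    ⟨Set.indicator_nonneg (fun _ _ => zero_le_one) _, Set.indicator_le_self' (fun _ _ => zero_le_one) _⟩
  have hF0 : ∀ z, 0 ≤ F z := fun z => Finset.sum_nonneg fun i _ => (hind01 _).1
  have hFn : ∀ z, F z ≤ (N k + 1 : ℕ) := fun z => by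
    calc F z ≤ ∑ _i : Fin (N k + 1), (1 : ℝ) := Finset.sum_le_sum fun i _ => (hind01 _).2
      _ = (N k + 1 : ℕ) := by simp
  have hψb : ∀ z, |γ * F z| ≤ γ * (N k + 1 : ℕ) := fun z => by
    rw [abs_mul, abs_of_pos hγ, abs_of_nonneg (hF0 z)]
    exact mul_le_mul_of_nonneg_left (hFn z) hγ.le
  have hent := Literature.Probability.Divergences.integral_le_toReal_klDiv_add_log hfin (hFm.const_mul γ) hψb
  -- the entropy budget
  have hKLreal : (InformationTheory.klDiv (Q k) Gm).toReal ≤ κ * (N k + 1) :=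
    ENNReal.toReal_le_of_le_ofReal (by positivity) hKLk
  -- the exponential moment under the Gibbs law: independent Gaussian velocities
  have hone : ∫⁻ w, ENNReal.ofReal (Real.exp (γ * ({v : V3 | R < ‖v‖}).indicator (fun _ => (1 : ℝ)) w)) ∂gauss =
      ENNReal.ofReal (1 + (Real.exp γ - 1) * pR) := by
    have hsplit : (fun w : V3 => ENNReal.ofReal (Real.exp (γ * ({v : V3 | R < ‖v‖}).indicator
        (fun _ => (1 : ℝ)) w))) = fun w => ({v : V3 | R < ‖v‖}).indicator
          (fun _ => ENNReal.ofReal (Real.exp γ)) w + ({v : V3 | R < ‖v‖})ᶜ.indicator (fun _ => 1) w := by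
      funext w
      by_cases hw : w ∈ {v : V3 | R < ‖v‖}
      · rw [Set.indicator_of_mem hw, Set.indicator_of_mem hw, Set.indicator_of_notMem (Set.notMem_compl_iff.2 hw),
          mul_one, add_zero]
      · rw [Set.indicator_of_notMem hw, Set.indicator_of_notMem hw, Set.indicator_of_mem (Set.mem_compl hw),
          mul_zero, Real.exp_zero, ENNReal.ofReal_one, zero_add]
    rw [hsplit, lintegral_add_left ((measurable_const.indicator (hmS R))), lintegral_indicator_const (hmS R),
      lintegral_indicator_const (hmS R).compl, one_mul, prob_compl_eq_one_sub (hmS R)]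
    have hμR : gauss {v : V3 | R < ‖v‖} = ENNReal.ofReal pR := (ENNReal.ofReal_toReal (measure_ne_top _ _)).symm
    rw [hμR, ← ENNReal.ofReal_one, ← ENNReal.ofReal_sub _ hpR0, ← ENNReal.ofReal_mul (Real.exp_pos γ).le,
      ← ENNReal.ofReal_add (by positivity) (by linarith)]
    congr 1
    ring
  have hexpF : ∫⁻ z, ENNReal.ofReal (Real.exp (γ * F z)) ∂Gm =
      ENNReal.ofReal ((1 + (Real.exp γ - 1) * pR) ^ (N k + 1)) := by
    have hmeas : Measurable fun z : Config (N k + 1) (Fin 3) T3 => ENNReal.ofReal (Real.exp (γ * F z)) :=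
      (hFm.const_mul γ).exp.ennreal_ofReal
    rw [hGm, lintegral_localGibbsMeasure continuous_const continuous_const continuous_const (fun _ => ha.le)
      (fun _ => hθ) σ (N k) hmeas]
    -- the inner velocity integral is the same for every position
    have hinner : ∀ x : Fin (N k + 1) → T3,
        ∫⁻ v, ENNReal.ofReal (Real.exp (γ * F (zipConfig (x, v)))) ∂velMeasure (fun _ => u₀) (fun _ => θ) x =
          ENNReal.ofReal ((1 + (Real.exp γ - 1) * pR) ^ (N k + 1)) := by
      intro x
      have hprod : ∀ v : Fin (N k + 1) → V3, ENNReal.ofReal (Real.exp (γ * F (zipConfig (x, v)))) =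
          ∏ i, ENNReal.ofReal (Real.exp (γ * ({v : V3 | R < ‖v‖}).indicator (fun _ => (1 : ℝ)) (v i))) := by
        intro v
        rw [← ENNReal.ofReal_prod_of_nonneg fun i _ => (Real.exp_pos _).le, ← Real.exp_sum, ← Finset.mul_sum]
        simp [hF, zipConfig_apply]
      simp_rw [hprod]
      rw [show velMeasure (fun _ : T3 => u₀) (fun _ : T3 => θ) x = Measure.pi fun _ : Fin (N k + 1) => gauss from rfl,
        lintegral_fintype_prod_eq_prod' (fun _ : Fin (N k + 1) => gauss)
          (f := fun (_ : Fin (N k + 1)) (w : V3) =>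
            ENNReal.ofReal (Real.exp (γ * ({v : V3 | R < ‖v‖}).indicator (fun _ => (1 : ℝ)) w)))
          fun _ => ((measurable_const.indicator (hmS R)).const_mul γ).exp.ennreal_ofReal]
      simp only [hone, Finset.prod_const, Finset.card_univ, Fintype.card_fin]
      rw [ENNReal.ofReal_pow (by nlinarith)]
    simp_rw [hinner]
    rw [lintegral_mul_const' _ _ ENNReal.ofReal_ne_top]
    haveI : IsProbabilityMeasure (localGibbsMeasure σ (fun _ : T3 => a) (fun _ : T3 => u₀) (fun _ : T3 => θ) (N k)) :=
      hGprob
    rw [lintegral_posWeight_eq_one continuous_const continuous_const continuous_const (fun _ => ha.le)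
      (fun _ => hθ) σ (N k), one_mul]
  have hexpF' : ∫ z, Real.exp (γ * F z) ∂Gm = (1 + (Real.exp γ - 1) * pR) ^ (N k + 1) := by
    rw [integral_eq_lintegral_of_nonneg_ae (Eventually.of_forall fun z => (Real.exp_pos _).le)
      (hFm.const_mul γ).exp.aestronglyMeasurable, hexpF, ENNReal.toReal_ofReal (by positivity)]
  have hlog : Real.log (∫ z, Real.exp (γ * F z) ∂Gm) ≤ (N k + 1 : ℕ) * ((Real.exp γ - 1) * pR) := by
    rw [hexpF', Real.log_pow]
    refine mul_le_mul_of_nonneg_left ?_ (by positivity)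
    have h := Real.log_le_sub_one_of_pos (show 0 < 1 + (Real.exp γ - 1) * pR by positivity)
    linarith
  -- conclusion
  have hn : (0 : ℝ) < ((N k + 1 : ℕ) : ℝ) := by positivity
  have hmain : γ * ∫ z, F z ∂Q k ≤ ((N k + 1 : ℕ) : ℝ) * (κ + (Real.exp γ - 1) * pR) := by
    rw [← integral_const_mul]
    refine hent.trans ?_
    push_cast at hKLreal hlog ⊢
    nlinarith
  have htail_le : (Real.exp γ - 1) * pR ≤ γ * δ / 2 := by
    calc (Real.exp γ - 1) * pR ≤ (Real.exp γ - 1) * p₀ := by gcongr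
      _ = γ * δ / 2 := by rw [hp₀def]; field_simp
  have hκγ : κ = γ * δ / 2 := by rw [hγdef]; field_simp
  rw [inv_mul_le_iff₀ hn]
  have h2 : γ * ∫ z, F z ∂Q k ≤ γ * (((N k + 1 : ℕ) : ℝ) * δ) := by
    calc γ * ∫ z, F z ∂Q k ≤ ((N k + 1 : ℕ) : ℝ) * (κ + (Real.exp γ - 1) * pR) := hmain
      _ ≤ ((N k + 1 : ℕ) : ℝ) * (γ * δ / 2 + γ * δ / 2) := by gcongr; exact hκγ.le
      _ = γ * (((N k + 1 : ℕ) : ℝ) * δ) := by ring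
  exact le_of_mul_le_mul_left h2 hγ

/-- Registered stub `stub_velocityTail` (line `FirstLemma`, helper of `stub_tangentBias`): uniform integrability of
velocities under a tangent family (= `velocityTail_of_isTangentFamily`). -/
theorem stub_velocityTail {σ a θ : ℝ} {u₀ : V3} {κ : ℝ} (ha : 0 < a) (hθ : 0 < θ) (hκ : 0 < κ)
    {N : ℕ → ℕ}
    {Φ : ∀ k, HardSphereFlow (Literature.Analysis.FluidPDE.Torus.geometry (Fin 3)) (hsDiameter σ (N k)) (N k + 1)}
    {Q : ∀ k, Measure (Config (N k + 1) (Fin 3) T3)} (hfam : IsTangentFamily σ a θ u₀ κ N Φ Q)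
    {δ : ℝ} (hδ : 0 < δ) :
    ∃ R : ℝ, 0 < R ∧ ∀ k, ((N k + 1 : ℕ) : ℝ)⁻¹ *
      ∫ z, (∑ i, ({v : V3 | R < ‖v‖}).indicator (fun _ => (1 : ℝ)) (z i).2) ∂Q k ≤ δ :=
  velocityTail_of_isTangentFamily ha hθ hκ hfam hδ

end Summit.AtomisticToContinuum.HydrodynamicLimit.Theorems.KiferCompactification
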